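import Summits.QuantumFields.BalabanUV.Beta.GAN24.DressedStepDifferenceRows
import Summits.QuantumFields.BalabanUV.Beta.GAN24.LegCompAssoc
import Summits.QuantumFields.BalabanUV.Beta.GAN24.EnvelopeBlockSum

/-!
# `BalabanUV.Beta.GAN24.CarrierSlotLegBottomKernel` — binder row G-an2-4 ∕ (CONV-C), W-slot, the (α-0) parity re-cut, located crux (Q-L-k₀), the DRIFT rows
# (leaf-03 g68 A-4∕A-5 `HΔw`; OWNER `b2b-balaban-gan24-p1` gen 37, part 8b — THE SLOT-LEG SIDE):
# **THE CARRIER's COMPOSITE SLOT LEGS WITH AN ARBITRARY DECAYING KERNEL AT THE LOWEST LEVEL — SUP AND CRUDE UNIT-GRADIENT ENVELOPES LINEAR IN THE KERNEL's CONSTANT.**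

NOT IN PRINT; OUR BOOKKEEPING ([folklore]: leaf-17's `Push4Bounds.LegDecay` calculus (`legDecay_colH`, `legDecay_legComp`) with the constants kept UNIFORM in the start level,
leaf-03 g55's `legChain_succ_left`, leaf-12's `EnvelopeBlockSum.supNorm_quo_sub_le_add_l1` for the ℓ¹ → block-label currency change, and MY part 7 `DressedStepDifferenceRows`
for the dressed kernels' uniform decay; 0 `def`, 0 cited facts, 0 `def … : Prop`, 0 sorry).  HONEST FRAMING (cell contract, verbatim): «discharging `BetaPertH` makes Bałaban's
UV stability UNCONDITIONAL — a real constructive-QFT result; it is NOT the continuum limit and NOT the Clay problem.»  HONEST DEPENDENCY (verbatim): «continuum YM on T⁴ ⇐ BetaPertH ∧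
nine spine estimates (0/9 proved); BetaPertH ⇐ (D1) ∧ (D4) ∧ CAP+tail; G-an2-4 gates asym, D1 and NE2/3/4.»

WHY.  leaf-03 g68's composite kernel-DIFFERENCE windows `HΔw` put `K♮ᴱ_{l+1} − K♮ᴱ_l` (or the mismatched `K♮ᴱ_l`) at the FIRST (lowest) step of a `(q+1)`-window; leaf-01's
(trilinear, two-slot-family) one-push∕k-fold window will ask for the composite SLOT legs `legChain (colH ∘ K′) p q` of the swapped family `K′ := update K♮ᴱ p M` a sup envelope
`a` and a unit-gradient envelope `a′` in the window's currency `e^{−κ‖quo L v − y‖∞}`, `L = N^{q+1}`.  Since `ν^l` (carried by `CM`) is the only smallness (H1Δw) needs, NO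
freezing gain is claimed: `a := CM·a₈`, `a′ := CM·a₈·(e^{κ₈}+1)` (crude: a unit shift of the fine argument moves the block label by at most one).
* §1 (generic `d`) `legDecay_legChain_uniform` — levelwise `LegDecay (l j) N C m` with ONE `(C, m)` ⟹ `∀ k, ∃ Ck mk > 0, ∀ m₀, LegDecay (legChain l m₀ k) (N^{k+1}) Ck mk`
  (leaf-17's recursion, the constants chosen BEFORE the start level); `legChain_congr_from`; `legDecay_update` (the swapped family is levelwise localised).
* §2 (generic `d`, ANY levelwise-decaying kernel family `K`, ANY `N ≥ 1`) **`exists_legChain_bottomKernel_legDecay`** — `∀ δM > 0, ∀ q, ∃ A mq > 0, ∀ M CM, 0 ≤ CM → Decays M CM δM →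
  ∀ p, LegDecay (legChain (j ↦ colH (update K p M j) N) p q) (N^{q+1}) (CM·A) mq` (`q = 0`: `colH M`; `q ≥ 1`: `legChain_succ_left` ⨾ congruence above `p` ⨾ `legDecay_legComp`
  with the bottom constant `CM` entering LINEARLY).
* §3 `abs_le_env_of_legDecay` (ℓ¹ decay at blocking `L` ⟹ the block-label envelope at the same rate), `abs_sub_le_env_of_legDecay` (the crude unit-gradient envelope, factor
  `e^{m}+1`), and the `d = 3` DRESSED INSTANCE **`exists_dressed_slotLeg_bottomKernel_envelopes`** (part 7's root-uniform `Decays (K♮ᴱ_j) C δ` as the family input): for every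
  `δM > 0` and length `q`, ONE `(a₈, κ₈)` with, for every in-block root, every `M` (`Decays M CM δM`), every level `p`:
  `|legChain (colH ∘ update K♮ᴱ p M) p q μ y κ v| ≤ CM·a₈·e^{−κ₈‖quo (Lc^{q+1}) v − y‖∞}` and `|…(v + Pi.single i 1) − …(v)| ≤ CM·a₈·(e^{κ₈}+1)·e^{−κ₈‖quo (Lc^{q+1}) v − y‖∞}`.
With MY parts 7 (Cauchy rows: `CM := cK·θ_K^l` for `M := K♮ᴱ_{l+1} − K♮ᴱ_l`, `CM := C` for `M := K♮ᴱ_l`) and 8a (the kernel-leg side) every LEG letter of `HΔw` is typed; the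
mixed-family carrier∕window itself is leaf-01's.  Asserts NOTHING about Bałaban's tables; NOT (H1Δw); NOTHING of (Q-L) ∕ (C)sym discharged; NEVER «G-an2-4 closed» as (CONV-C);
NOT D1, NOT `BetaPertH`, NOT continuum, NOT Clay; not in print.  Unit `b2b-balaban-gan24-p1` (BINDER row G-an2-4 OWNER; CRUX PROVER on C-R8° CT-ROUTE), gen 37, 2026-08-23.
-/

noncomputable section

open Finset
open scoped BigOperators
open Literature.MathematicalPhysics.QuantumFieldTheory
open Literature.MathematicalPhysics.QuantumFieldTheory.LatticeForm (quo)
open Literature.MathematicalPhysics.QuantumFieldTheory.Balaban1983to89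
open Literature.MathematicalPhysics.QuantumFieldTheory.Balaban1983to89.Beta
open B4ContourShift (supNorm supNorm_nonneg)
open B12Sec2to5 (l1 l1_nonneg)
open ExpKernelCalculus (MKer Decays Zl Zl_nonneg Zl_pos l1_sub_symm)
open OneStepResolventKernel (Fib quo_zsmul)
open OneStepKernelFamily (KInvStep colH)
open AffineAveraging (Site box toSite)
open Summit.QuantumFields.BalabanUV.Beta.HessKerDressedUnits (unitK)
open Summit.QuantumFields.BalabanUV.Beta.AxialDressingRooted (coDressKBmAt)
open Summit.QuantumFields.BalabanUV.Beta.GAN24.CombesThomas (sfStep smStep)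
open Summit.QuantumFields.BalabanUV.Beta.GAN24.Push4 (legComp legComp_apply)
open Summit.QuantumFields.BalabanUV.Beta.GAN24.Push4Bounds (LegDecay LegDecay.nonneg LegDecay.abs_le legDecay_colH)
open Summit.QuantumFields.BalabanUV.Beta.GAN24.Push4NestAux (legDecay_legComp)
open Summit.QuantumFields.BalabanUV.Beta.GAN24.Push4Iter (LegFam legChain legChain_zero legChain_succ)
open Summit.QuantumFields.BalabanUV.Beta.GAN24.LegCompAssoc (legChain_succ_left)
open Summit.QuantumFields.BalabanUV.Beta.GAN24.EnvelopeBlockSum (supNorm_quo_sub_le_add_l1)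
open Summit.QuantumFields.BalabanUV.Beta.GAN24.DressedStepDifferenceRows (exists_dressedStep_rows)

namespace Summit.QuantumFields.BalabanUV.Beta.GAN24.CarrierSlotLegBottomKernel

/-! ## §1 Uniform localisation of chains; the swapped family -/

section Generic

variable {d : ℕ}

/-- [folklore] **THE CHAIN IS LOCALISED WITH CONSTANTS UNIFORM IN THE START LEVEL**: if every level's leg family obeys `LegDecay (l j) N C m` with ONE `(C, m)`, `0 < m`, then for
every length `k` there are `Ck, mk > 0` with `LegDecay (legChain l m₀ k) (N^{k+1}) Ck mk` for EVERY start `m₀` (leaf-17's `legDecay_legChain` recursion, constants first). -/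
theorem legDecay_legChain_uniform {l : ℕ → LegFam d} {N : ℕ} {C m : ℝ} (hm : 0 < m) (hl : ∀ j, LegDecay (l j) N C m) :
    ∀ k : ℕ, ∃ Ck mk : ℝ, 0 < mk ∧ ∀ m₀, LegDecay (legChain l m₀ k) (N ^ (k + 1)) Ck mk
  | 0 => ⟨C, m, hm, fun m₀ => by simpa [legChain_zero, pow_one] using hl m₀⟩
  | k + 1 => by
    obtain ⟨C₂, m₂, hm₂, h₂⟩ := legDecay_legChain_uniform hm hl k
    obtain ⟨m', hm'0, hm'₂, hm'₁⟩ : ∃ m' : ℝ, 0 < m' ∧ m' ≤ m₂ ∧ m' * (N ^ (k + 1) : ℕ) < m := by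
      refine ⟨min m₂ (m / (2 * (((N ^ (k + 1) : ℕ) : ℝ) + 1))), lt_min hm₂ (by positivity), min_le_left _ _, ?_⟩
      have hN : (0 : ℝ) ≤ ((N ^ (k + 1) : ℕ) : ℝ) := Nat.cast_nonneg _
      have hpos : (0 : ℝ) < 2 * (((N ^ (k + 1) : ℕ) : ℝ) + 1) := by positivity
      have h1 : min m₂ (m / (2 * (((N ^ (k + 1) : ℕ) : ℝ) + 1))) * ((N ^ (k + 1) : ℕ) : ℝ)
          ≤ m / (2 * (((N ^ (k + 1) : ℕ) : ℝ) + 1)) * ((N ^ (k + 1) : ℕ) : ℝ) := mul_le_mul_of_nonneg_right (min_le_right _ _) hN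
      have h2 : m / (2 * (((N ^ (k + 1) : ℕ) : ℝ) + 1)) * ((N ^ (k + 1) : ℕ) : ℝ) < m := by
        calc m / (2 * (((N ^ (k + 1) : ℕ) : ℝ) + 1)) * ((N ^ (k + 1) : ℕ) : ℝ)
            < m / (2 * (((N ^ (k + 1) : ℕ) : ℝ) + 1)) * (2 * (((N ^ (k + 1) : ℕ) : ℝ) + 1)) :=
              mul_lt_mul_of_pos_left (by linarith) (div_pos hm hpos)
          _ = m := div_mul_cancel₀ _ hpos.ne'
      exact h1.trans_lt h2
    refine ⟨(d + 1 : ℕ) * (C * C₂ * Zl (d + 1) (m - m' * ((N ^ (k + 1) : ℕ) : ℝ))), m', hm'0, fun m₀ => ?_⟩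
    rw [legChain_succ, pow_succ]
    exact legDecay_legComp (hl (m₀ + k + 1)) (h₂ m₀) hm'0.le hm'₂ hm'₁

/-- [folklore] The chain depends only on the legs of the levels `≥ m₀`. -/
theorem legChain_congr_from {l l' : ℕ → LegFam d} {m₀ : ℕ} (h : ∀ j, m₀ ≤ j → l j = l' j) :
    ∀ k, legChain l m₀ k = legChain l' m₀ k
  | 0 => by rw [legChain_zero, legChain_zero, h m₀ le_rfl]
  | k + 1 => by rw [legChain_succ, legChain_succ, legChain_congr_from h k, h (m₀ + k + 1) (by omega)]

/-- [folklore] The `ℋ`-columns of the swapped family `update K p M` are levelwise localised at ONE rate (the smaller of the two). -/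
theorem legDecay_colH_update {K : ℕ → MKer (d + 1) (Fib d)} {N : ℕ} {C δ CM δM : ℝ} (hK : ∀ j, Decays (K j) C δ)
    {M : MKer (d + 1) (Fib d)} (hM : Decays M CM δM) (hC : 0 ≤ C) (p : ℕ) :
    ∀ j, LegDecay (colH (Function.update K p M j) N) N (max C CM) (min δ δM) := by
  intro j
  by_cases hj : j = p
  · subst hj
    intro μ y κ u
    have h := legDecay_colH (N := N) hM μ y κ u
    simp only [Function.update_self]
    refine h.trans (mul_le_mul (le_max_right _ _) (Real.exp_le_exp.2 ?_) (Real.exp_pos _).le (hC.trans (le_max_left _ _)))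
    have := l1_nonneg (u - (N : ℤ) • y); nlinarith [min_le_right δ δM]
  · intro μ y κ u
    have h := legDecay_colH (N := N) (hK j) μ y κ u
    simp only [Function.update_of_ne hj]
    refine h.trans (mul_le_mul (le_max_left _ _) (Real.exp_le_exp.2 ?_) (Real.exp_pos _).le (hC.trans (le_max_left _ _)))
    have := l1_nonneg (u - (N : ℤ) • y); nlinarith [min_le_left δ δM]

/-! ## §2 The composite slot legs of the swapped family: `LegDecay` with the bottom constant linear -/

/-- NOT IN PRINT; OUR BOOKKEEPING.  **THE COMPOSITE SLOT LEGS WITH AN ARBITRARY DECAYING KERNEL AT THE LOWEST LEVEL ARE LOCALISED, LINEARLY IN ITS CONSTANT** (generic `d`; any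
levelwise-decaying family `K` with ONE `(C, δ)`; `1 ≤ N`): `∀ δM > 0, ∀ q, ∃ A mq > 0, ∀ M CM, 0 ≤ CM → Decays M CM δM → ∀ p, LegDecay (legChain (j ↦ colH (update K p M j) N) p q) (N^{q+1}) (CM·A) mq`. -/
theorem exists_legChain_bottomKernel_legDecay {K : ℕ → MKer (d + 1) (Fib d)} {N : ℕ} (hN : 1 ≤ N) {C δ : ℝ} (hC : 0 ≤ C) (hδ : 0 < δ)
    (hK : ∀ j, Decays (K j) C δ) {δM : ℝ} (hδM : 0 < δM) :
    ∀ q : ℕ, ∃ A mq : ℝ, 0 ≤ A ∧ 0 < mq ∧ ∀ (M : MKer (d + 1) (Fib d)) (CM : ℝ), 0 ≤ CM → Decays M CM δM →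
      ∀ p : ℕ, LegDecay (legChain (fun j => colH (Function.update K p M j) N) p q) (N ^ (q + 1)) (CM * A) mq
  | 0 => ⟨1, δM, zero_le_one, hδM, fun M CM hCM hM p => by
      intro μ y κ u
      have h := legDecay_colH (N := N) hM μ y κ u
      simpa [legChain_zero, Function.update_self, pow_one, mul_one] using h⟩
  | q + 1 => by
    -- the chain above level `p` is the family `K`'s: uniform localisation
    obtain ⟨Cq, mq, hmq, hup⟩ := legDecay_legChain_uniform (N := N) hδ (fun j => legDecay_colH (N := N) (hK j)) q
    -- a composite rate `m'` with `m' ≤ δM` and `m'·N < mq`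
    obtain ⟨m', hm'0, hm'M, hm'q⟩ : ∃ m' : ℝ, 0 < m' ∧ m' ≤ δM ∧ m' * (N : ℕ) < mq := by
      refine ⟨min δM (mq / (2 * ((N : ℝ) + 1))), lt_min hδM (by positivity), min_le_left _ _, ?_⟩
      have hN0 : (0 : ℝ) ≤ (N : ℝ) := Nat.cast_nonneg _
      have hpos : (0 : ℝ) < 2 * ((N : ℝ) + 1) := by positivity
      have h1 : min δM (mq / (2 * ((N : ℝ) + 1))) * (N : ℝ) ≤ mq / (2 * ((N : ℝ) + 1)) * (N : ℝ) := mul_le_mul_of_nonneg_right (min_le_right _ _) hN0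
      have h2 : mq / (2 * ((N : ℝ) + 1)) * (N : ℝ) < mq := by
        calc mq / (2 * ((N : ℝ) + 1)) * (N : ℝ) < mq / (2 * ((N : ℝ) + 1)) * (2 * ((N : ℝ) + 1)) := mul_lt_mul_of_pos_left (by linarith) (div_pos hmq hpos)
          _ = mq := div_mul_cancel₀ _ hpos.ne'
      exact h1.trans_lt h2
    have hCq : 0 ≤ Cq := (hup 0).nonneg
    refine ⟨(d + 1 : ℕ) * (Cq * Zl (d + 1) (mq - m' * N)), m', by have := Zl_nonneg (D := d + 1) (show 0 < mq - m' * N by linarith); positivity, hm'0, ?_⟩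
    intro M CM hCM hM p
    -- the swapped family is levelwise localised, so the chain unrolls at its fine end
    have hdec : ∀ j, ∃ C' m'' : ℝ, 0 < m'' ∧ LegDecay ((fun j => colH (Function.update K p M j) N) j) N C' m'' :=
      fun j => ⟨max C CM, min δ δM, lt_min hδ hδM, legDecay_colH_update hK hM hC p j⟩
    have hcongr : legChain (fun j => colH (Function.update K p M j) N) (p + 1) q = legChain (fun j => colH (K j) N) (p + 1) q :=
      legChain_congr_from (fun j hj => by rw [Function.update_of_ne (show j ≠ p by omega)]) q
    rw [legChain_succ_left hN hdec p q, hcongr]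
    simp only [Function.update_self]
    -- `legComp (colH M N) (upper chain)`: bottom constant `CM` linear
    have h := legDecay_legComp (hup (p + 1)) (legDecay_colH (N := N) hM) hm'0.le hm'M (by exact_mod_cast hm'q)
    rw [show N * N ^ (q + 1) = N ^ (q + 1 + 1) by ring] at h
    intro μ y κ u
    refine (h μ y κ u).trans (le_of_eq ?_)
    push_cast; ring

/-! ## §3 The window's currency: block-label envelopes; the dressed instance -/

/-- [folklore] **ℓ¹ DECAY AT BLOCKING `L` GIVES THE BLOCK-LABEL ENVELOPE AT THE SAME RATE**: `LegDecay r L C m`, `0 ≤ m`, `1 ≤ L` ⟹ `|r μ y κ v| ≤ C·e^{−m‖quo L v − y‖∞}`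
(`‖quo L v − y‖∞ ≤ |v − L•y|₁`, leaf-12's `supNorm_quo_sub_le_add_l1` at the block centre). -/
theorem abs_le_env_of_legDecay {r : LegFam d} {L : ℕ} (hL : 1 ≤ L) {C m : ℝ} (h : LegDecay r L C m) (hm : 0 ≤ m)
    (μ : Fin (d + 1)) (y : Site (d + 1)) (κ : Fin (d + 1)) (v : Site (d + 1)) :
    |r μ y κ v| ≤ C * Real.exp (-(m * supNorm (quo L v - y))) := by
  haveI : NeZero L := ⟨by omega⟩
  have h1 := h μ y κ v
  have hle : supNorm (quo L v - y) ≤ l1 (v - (L : ℤ) • y) := by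
    have h2 := supNorm_quo_sub_le_add_l1 (d := d) hL v ((L : ℤ) • y) y
    rw [quo_zsmul, sub_self, show supNorm (0 : Fin (d + 1) → ℤ) = 0 by unfold supNorm; simp, zero_add, l1_sub_symm] at h2
    exact h2
  refine h1.trans (mul_le_mul_of_nonneg_left (Real.exp_le_exp.2 ?_) h.nonneg)
  nlinarith

/-- [folklore] **THE CRUDE UNIT-GRADIENT ENVELOPE**: under the same hypotheses `|r μ y κ (v + e_i) − r μ y κ v| ≤ C·(e^{m}+1)·e^{−m‖quo L v − y‖∞}` (the shifted point's block label
moves by at most one: `supNorm_quo_sub_le_add_l1` with `|e_i|₁ = 1`). -/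
theorem abs_sub_le_env_of_legDecay {r : LegFam d} {L : ℕ} (hL : 1 ≤ L) {C m : ℝ} (h : LegDecay r L C m) (hm : 0 ≤ m)
    (μ : Fin (d + 1)) (y : Site (d + 1)) (κ : Fin (d + 1)) (v : Site (d + 1)) (i : Fin (d + 1)) :
    |r μ y κ (v + Pi.single i 1) - r μ y κ v| ≤ C * (Real.exp m + 1) * Real.exp (-(m * supNorm (quo L v - y))) := by
  have hC := h.nonneg
  have h1 := abs_le_env_of_legDecay hL h hm μ y κ (v + Pi.single i 1)
  have h2 := abs_le_env_of_legDecay hL h hm μ y κ v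
  -- the shifted block label is within one of the unshifted one
  have hwob : supNorm (quo L v - y) ≤ supNorm (quo L (v + Pi.single i 1) - y) + 1 := by
    have h3 := supNorm_quo_sub_le_add_l1 (d := d) hL v (v + Pi.single i 1) y
    have hl1 : l1 (v + Pi.single i 1 - v) = 1 := by
      rw [add_sub_cancel_left]
      unfold l1
      rw [Finset.sum_eq_single i (fun j _ hj => by simp [hj]) (fun hh => (hh (Finset.mem_univ i)).elim)]
      simp
    linarith
  have hshift : Real.exp (-(m * supNorm (quo L (v + Pi.single i 1) - y))) ≤ Real.exp m * Real.exp (-(m * supNorm (quo L v - y))) := by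
    rw [← Real.exp_add, Real.exp_le_exp]; nlinarith
  calc |r μ y κ (v + Pi.single i 1) - r μ y κ v| ≤ |r μ y κ (v + Pi.single i 1)| + |r μ y κ v| := abs_sub _ _
    _ ≤ C * (Real.exp m * Real.exp (-(m * supNorm (quo L v - y)))) + C * Real.exp (-(m * supNorm (quo L v - y))) :=
        add_le_add (h1.trans (mul_le_mul_of_nonneg_left hshift hC)) h2
    _ = _ := by ring

end Generic

section Three

variable {Lc : ℕ} [NeZero Lc]

/-- NOT IN PRINT; OUR BOOKKEEPING.  **THE DRESSED INSTANCE** (as displayed in the module docstring; `d = 3`, `2 ≤ Lc`, MY part 7 for the family's uniform decay): for every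
`δM > 0` and length `q` ONE `(a₈, κ₈)` with, for every in-block root, every kernel `M` with `Decays M CM δM` (`0 ≤ CM`), every level `p` and all `μ y κ v i`:
sup `≤ CM·a₈·e^{−κ₈‖quo (Lc^{q+1}) v − y‖∞}` and crude unit gradient `≤ CM·a₈·(e^{κ₈}+1)·e^{−κ₈‖quo (Lc^{q+1}) v − y‖∞}` for `legChain (colH ∘ update K♮ᴱ p M) p q`. -/
theorem exists_dressed_slotLeg_bottomKernel_envelopes (hLc : 2 ≤ Lc) {δM : ℝ} (hδM : 0 < δM) (q : ℕ) :
    ∃ a₈ κ₈ : ℝ, 0 ≤ a₈ ∧ 0 < κ₈ ∧ ∀ (rr : Fin (3 + 1) → ℕ), rr ∈ box (3 + 1) Lc →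
      ∀ (M : MKer (3 + 1) (Fib 3)) (CM : ℝ), 0 ≤ CM → Decays M CM δM → ∀ (p : ℕ) (μ : Fin (3 + 1)) (y : Site (3 + 1)) (κ : Fin (3 + 1)) (v : Site (3 + 1)),
        |legChain (fun j => colH (Function.update (fun j => unitK (sfStep Lc j) (smStep 3 Lc j) (coDressKBmAt (toSite rr) Lc (KInvStep (d := 3) Lc j))) p M j) Lc) p q μ y κ v|
            ≤ CM * a₈ * Real.exp (-(κ₈ * supNorm (quo (Lc ^ (q + 1)) v - y))) ∧
        ∀ i : Fin (3 + 1),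
          |legChain (fun j => colH (Function.update (fun j => unitK (sfStep Lc j) (smStep 3 Lc j) (coDressKBmAt (toSite rr) Lc (KInvStep (d := 3) Lc j))) p M j) Lc) p q
                μ y κ (v + Pi.single i 1)
            - legChain (fun j => colH (Function.update (fun j => unitK (sfStep Lc j) (smStep 3 Lc j) (coDressKBmAt (toSite rr) Lc (KInvStep (d := 3) Lc j))) p M j) Lc) p q
                μ y κ v|
            ≤ CM * a₈ * (Real.exp κ₈ + 1) * Real.exp (-(κ₈ * supNorm (quo (Lc ^ (q + 1)) v - y))) := by
  classical
  have hLc1 : 1 ≤ Lc := le_trans (by norm_num) hLc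
  have hLq : 1 ≤ Lc ^ (q + 1) := Nat.one_le_pow _ _ hLc1
  obtain ⟨C, cK, θ, δ, hδ, -, -, hC, -, hrows⟩ := exists_dressedStep_rows (Lc := Lc) hLc
  -- per root the family's uniform rows feed §2; the constants do not depend on the root (they depend on `(C, δ, δM, q)` only) — so choose them at the first root and reuse:
  -- we obtain them abstractly from §2 applied to ANY family with rows `(C, δ)`.
  have key : ∃ A mq : ℝ, 0 ≤ A ∧ 0 < mq ∧ ∀ (K : ℕ → MKer (3 + 1) (Fib 3)), (∀ j, Decays (K j) C δ) →
      ∀ (M : MKer (3 + 1) (Fib 3)) (CM : ℝ), 0 ≤ CM → Decays M CM δM →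
        ∀ p : ℕ, LegDecay (legChain (fun j => colH (Function.update K p M j) Lc) p q) (Lc ^ (q + 1)) (CM * A) mq := by
    -- §2's constants are built from `(C, δ, δM, q, Lc, d)` alone: re-run its construction once for a fixed witness family and observe it is family-free.
    -- We realise this by proving the statement for all families simultaneously by the same induction (inlined via §2 on each family and extracting common constants is not
    -- possible after the fact), so we appeal to §2 with the family universally quantified INSIDE: this is exactly `exists_legChain_bottomKernel_legDecay` read with `K` after `q`.
    have h := fun (K : ℕ → MKer (3 + 1) (Fib 3)) (hK : ∀ j, Decays (K j) C δ) => exists_legChain_bottomKernel_legDecay (d := 3) (N := Lc) hLc1 hC hδ hK hδM q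
    -- the constants produced by §2 are literally the same term for every `K`; Lean's `choose` would make them `K`-dependent, so we rebuild them uniformly:
    -- use §2 on the CONSTANT dummy family `fun _ => 0`? Its rows hold with `(C, δ)` too (`0 ≤ C`), and the constants are the same term — but the STATEMENT we need is about `K`.
    -- Therefore we prove the uniform statement directly by repeating §2's induction with `K` quantified inside.
    clear h
    induction q with
    | zero =>
      exact ⟨1, δM, zero_le_one, hδM, fun K hK M CM hCM hM p => by
        intro μ y κ u
        have h := legDecay_colH (N := Lc) hM μ y κ u
        simpa [legChain_zero, Function.update_self, pow_one, mul_one] using h⟩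
    | succ q ih =>
      -- NOTE: the envelope lemma for length `q+1` only needs the UPPER chain's uniform localisation, which is family-uniform by `legDecay_legChain_uniform`'s explicit constants;
      -- we re-derive it with `K` inside by the same explicit recursion.
      have hupK : ∃ Cq mq : ℝ, 0 < mq ∧ ∀ (K : ℕ → MKer (3 + 1) (Fib 3)), (∀ j, Decays (K j) C δ) → ∀ m₀, LegDecay (legChain (fun j => colH (K j) Lc) m₀ q) (Lc ^ (q + 1)) Cq mq := by
        clear ih hLq
        induction q with
        | zero => exact ⟨C, δ, hδ, fun K hK m₀ => by simpa [legChain_zero, pow_one] using legDecay_colH (N := Lc) (hK m₀)⟩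
        | succ q ih2 =>
          obtain ⟨C₂, m₂, hm₂, h₂⟩ := ih2
          obtain ⟨m', hm'0, hm'₂, hm'₁⟩ : ∃ m' : ℝ, 0 < m' ∧ m' ≤ m₂ ∧ m' * (Lc ^ (q + 1) : ℕ) < δ := by
            refine ⟨min m₂ (δ / (2 * (((Lc ^ (q + 1) : ℕ) : ℝ) + 1))), lt_min hm₂ (by positivity), min_le_left _ _, ?_⟩
            have hN : (0 : ℝ) ≤ ((Lc ^ (q + 1) : ℕ) : ℝ) := Nat.cast_nonneg _
            have hpos : (0 : ℝ) < 2 * (((Lc ^ (q + 1) : ℕ) : ℝ) + 1) := by positivity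
            have h1 : min m₂ (δ / (2 * (((Lc ^ (q + 1) : ℕ) : ℝ) + 1))) * ((Lc ^ (q + 1) : ℕ) : ℝ)
                ≤ δ / (2 * (((Lc ^ (q + 1) : ℕ) : ℝ) + 1)) * ((Lc ^ (q + 1) : ℕ) : ℝ) := mul_le_mul_of_nonneg_right (min_le_right _ _) hN
            have h2 : δ / (2 * (((Lc ^ (q + 1) : ℕ) : ℝ) + 1)) * ((Lc ^ (q + 1) : ℕ) : ℝ) < δ := by
              calc δ / (2 * (((Lc ^ (q + 1) : ℕ) : ℝ) + 1)) * ((Lc ^ (q + 1) : ℕ) : ℝ)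
                  < δ / (2 * (((Lc ^ (q + 1) : ℕ) : ℝ) + 1)) * (2 * (((Lc ^ (q + 1) : ℕ) : ℝ) + 1)) := mul_lt_mul_of_pos_left (by linarith) (div_pos hδ hpos)
                _ = δ := div_mul_cancel₀ _ hpos.ne'
            exact h1.trans_lt h2
          refine ⟨(3 + 1 : ℕ) * (C * C₂ * Zl (3 + 1) (δ - m' * ((Lc ^ (q + 1) : ℕ) : ℝ))), m', hm'0, fun K hK m₀ => ?_⟩
          rw [legChain_succ, pow_succ]
          exact legDecay_legComp (legDecay_colH (N := Lc) (hK (m₀ + q + 1))) (h₂ K hK m₀) hm'0.le hm'₂ hm'₁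
      obtain ⟨Cq, mq, hmq, hup⟩ := hupK
      obtain ⟨m', hm'0, hm'M, hm'q⟩ : ∃ m' : ℝ, 0 < m' ∧ m' ≤ δM ∧ m' * (Lc : ℕ) < mq := by
        refine ⟨min δM (mq / (2 * ((Lc : ℝ) + 1))), lt_min hδM (by positivity), min_le_left _ _, ?_⟩
        have hN0 : (0 : ℝ) ≤ (Lc : ℝ) := Nat.cast_nonneg _
        have hpos : (0 : ℝ) < 2 * ((Lc : ℝ) + 1) := by positivity
        have h1 : min δM (mq / (2 * ((Lc : ℝ) + 1))) * (Lc : ℝ) ≤ mq / (2 * ((Lc : ℝ) + 1)) * (Lc : ℝ) := mul_le_mul_of_nonneg_right (min_le_right _ _) hN0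
        have h2 : mq / (2 * ((Lc : ℝ) + 1)) * (Lc : ℝ) < mq := by
          calc mq / (2 * ((Lc : ℝ) + 1)) * (Lc : ℝ) < mq / (2 * ((Lc : ℝ) + 1)) * (2 * ((Lc : ℝ) + 1)) := mul_lt_mul_of_pos_left (by linarith) (div_pos hmq hpos)
            _ = mq := div_mul_cancel₀ _ hpos.ne'
        exact h1.trans_lt h2
      have hZ := Zl_nonneg (D := 3 + 1) (show 0 < mq - m' * Lc by linarith)
      refine ⟨(3 + 1 : ℕ) * (Cq * Zl (3 + 1) (mq - m' * Lc)), m', ?_, hm'0, fun K hK M CM hCM hM p => ?_⟩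
      · have hCq : 0 ≤ Cq := by
          have := (hup (fun _ => 0) (fun j x y a b => by
            simp only [Pi.zero_apply, abs_zero]; positivity) 0).nonneg
          exact this
        positivity
      have hdec : ∀ j, ∃ C' m'' : ℝ, 0 < m'' ∧ LegDecay ((fun j => colH (Function.update K p M j) Lc) j) Lc C' m'' :=
        fun j => ⟨max C CM, min δ δM, lt_min hδ hδM, legDecay_colH_update hK hM hC p j⟩
      have hcongr : legChain (fun j => colH (Function.update K p M j) Lc) (p + 1) q = legChain (fun j => colH (K j) Lc) (p + 1) q :=
        legChain_congr_from (fun j hj => by rw [Function.update_of_ne (show j ≠ p by omega)]) q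
      rw [legChain_succ_left hLc1 hdec p q, hcongr]
      simp only [Function.update_self]
      have h := legDecay_legComp (hup K hK (p + 1)) (legDecay_colH (N := Lc) hM) hm'0.le hm'M (by exact_mod_cast hm'q)
      rw [show Lc * Lc ^ (q + 1) = Lc ^ (q + 1 + 1) by ring] at h
      intro μ y κ u
      refine (h μ y κ u).trans (le_of_eq ?_)
      push_cast; ring
  obtain ⟨A, mq, hA, hmq, hkey⟩ := key
  refine ⟨A, mq, hA, hmq, ?_⟩
  intro rr hrr M CM hCM hM p μ y κ v
  have hLD := hkey _ (hrows rr hrr).1 M CM hCM hM p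
  exact ⟨abs_le_env_of_legDecay hLq hLD hmq.le μ y κ v, fun i => abs_sub_le_env_of_legDecay hLq hLD hmq.le μ y κ v i⟩

end Three

end Summit.QuantumFields.BalabanUV.Beta.GAN24.CarrierSlotLegBottomKernel

end
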